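import Summits.Ventures.Crystal3D.Theorems.StickyWulffConstantTextureBuildHeal
import HarnessLib

/-!
# TB-1 brick L-HEAL, labelled form: the healed configuration as a unit packing `x' : Fin N' → E3` with `6N' − b(x') ≤ 6N − b(x)`
# (lane T, crux `TextureLiminfV5`, stmt-Ventures-23912; the `(N', x')` of the healed binder `CoverH`, '…TextureBuildHealedComposition')

HONEST FRAMING. Venture `Summits/Ventures/Crystal3D` (cell `crystal3d-full`), route `route-Ventures-StickyWulffConstant`, helper `--supports` the
law-v5 crux `TextureLiminfV5` (stmt-Ventures-23912).  Pure finite combinatorics over '…TextureBuildHeal' (census-free, standard axioms).  Nothing about any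
cover or texture is claimed; F-C1 not moved.

* `exists_enum_of_separated` — a `1`-separated finite point set `Y` IS a labelled unit packing: `∃ x' : Fin Y.card → E3`, `IsUnitPacking x'`,
  `Finset.univ.image x' = Y`;
* **`exists_healed_packing`** — for a unit packing `x : Fin N → E3`, a region `B`, a moved Barlow stacking `S` and the finite set `V` of ALL `S`-sites in `B`
  with a clean solid collar (hypotheses of `contactDeficiency_heal_le`), there are `N'` and a unit packing `x' : Fin N' → E3` enumerating
  `heal (univ.image x) V B` with `6N' − b(x') ≤ 6N − b(x)` and `N ≤ N' + #{i | x i ∈ B}` — exactly the `(N', x')` the healed TB-cover binder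
  `CoverH` asks for, once `#{i | x i ∈ B}` (the healed junk) is `o(N)`.
-/

noncomputable section

namespace Summit.Ventures.Crystal3D.Theorems

open Finset Summit.Ventures.Crystal3D
open Literature.MathematicalPhysics.StatisticalMechanics (IsHaggSeq contactDeficiency)
open Summit.Ventures.Crystal3D.Cruxes.TextureLiminf.TexShadow (E3 stacking)

/-- A `1`-separated finite point set is (the range of) a labelled unit packing. -/
theorem exists_enum_of_separated (Y : Finset E3) (hY : ∀ p ∈ Y, ∀ q ∈ Y, p ≠ q → 1 ≤ dist p q) :
    ∃ x' : Fin Y.card → E3, IsUnitPacking x' ∧ Finset.univ.image x' = Y := by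
  classical
  let e : Fin Y.card ≃ {p // p ∈ Y} := Y.equivFin.symm
  refine ⟨fun i => (e i : E3), ?_, ?_⟩
  · intro i j hij
    exact hY _ (e i).2 _ (e j).2 fun h => hij (e.injective (Subtype.ext h))
  · ext p
    simp only [Finset.mem_image, Finset.mem_univ, true_and]
    constructor
    · rintro ⟨i, rfl⟩
      exact (e i).2
    · intro hp
      exact ⟨e.symm ⟨p, hp⟩, by simp⟩

/-- The range of a unit packing is a `1`-separated point set (Finset form). -/
theorem image_sep {N : ℕ} {x : Fin N → E3} (hx : IsUnitPacking x) :
    ∀ p ∈ Finset.univ.image x, ∀ q ∈ Finset.univ.image x, p ≠ q → 1 ≤ dist p q := by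
  classical
  intro p hp q hq hpq
  obtain ⟨i, -, rfl⟩ := Finset.mem_image.1 hp
  obtain ⟨j, -, rfl⟩ := Finset.mem_image.1 hq
  exact hx fun h => hpq (by rw [h])

/-- **L-HEAL, LABELLED**: the healed configuration of a unit packing (grain lattice `S` refilled in the region `B`, clean solid collar) is a unit packing
`x' : Fin N' → E3` with no larger deficiency and at least `N − #{i | x i ∈ B}` balls. -/
theorem exists_healed_packing {N : ℕ} {x : Fin N → E3} (hx : IsUnitPacking x) {L : E3 ≃ₗᵢ[ℝ] E3} {s : E3} {σ : ℤ → ℤ} (hσ : IsHaggSeq σ)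
    (B : Set E3) [DecidablePred (· ∈ B)] (V : Finset E3)
    (hVS : ∀ v ∈ V, v ∈ stacking L s σ) (hVB : ∀ v ∈ V, v ∈ B) (hVall : ∀ w ∈ stacking L s σ, w ∈ B → w ∈ V)
    (hcolS : ∀ i, x i ∉ B → (∃ y, (y ∈ Finset.univ.image x ∨ y ∈ V) ∧ y ∈ B ∧ dist (x i) y ≤ 1) → x i ∈ stacking L s σ)
    (hcolX : ∀ i, x i ∉ B → (∃ y, (y ∈ Finset.univ.image x ∨ y ∈ V) ∧ y ∈ B ∧ dist (x i) y ≤ 1) →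
      ∀ w ∈ stacking L s σ, dist (x i) w = 1 → w ∉ B → w ∈ Finset.univ.image x)
    (hcolV : ∀ v ∈ V, ∀ w ∈ stacking L s σ, dist v w = 1 → w ∉ B → w ∈ Finset.univ.image x) :
    ∃ (N' : ℕ) (x' : Fin N' → E3), IsUnitPacking x' ∧
      Finset.univ.image x' = heal (Finset.univ.image x) V B ∧
      6 * (N' : ℝ) - (numContacts x' : ℝ) ≤ 6 * (N : ℝ) - (numContacts x : ℝ) ∧
      N ≤ N' + (Finset.univ.filter fun i => x i ∈ B).card := by
  classical
  set X : Finset E3 := Finset.univ.image x with hXdef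
  have hXsep := image_sep hx
  have hmemX : ∀ a ∈ X, ∃ i, x i = a := fun a ha => by
    obtain ⟨i, -, hi⟩ := Finset.mem_image.1 ha; exact ⟨i, hi⟩
  -- the healed point set is a packing
  have hsep : ∀ p ∈ heal X V B, ∀ q ∈ heal X V B, p ≠ q → 1 ≤ dist p q := by
    refine heal_sep hσ hXsep hVS fun a ha haB v hv hd => ?_
    obtain ⟨i, rfl⟩ := hmemX a ha
    exact hcolS i haB ⟨v, Or.inr hv, hVB v hv, hd.le⟩
  obtain ⟨x', hx', himg⟩ := exists_enum_of_separated (heal X V B) hsep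
  refine ⟨(heal X V B).card, x', hx', himg, ?_, ?_⟩
  · -- deficiency
    rw [← contactDeficiency_image_eq x hx.injective, ← contactDeficiency_image_eq x' hx'.injective, himg]
    refine contactDeficiency_heal_le hσ hXsep hVS hVB hVall ?_ ?_ hcolV
    · intro a ha haB h
      obtain ⟨i, rfl⟩ := hmemX a ha
      exact hcolS i haB h
    · intro a ha haB h
      obtain ⟨i, rfl⟩ := hmemX a ha
      exact hcolX i haB h
  · -- count
    have h1 := card_le_card_heal_add X V B
    have h2 : X.card = N := card_image_univ_eq x hx.injective
    have h3 : (X.filter fun a => a ∈ B).card = (Finset.univ.filter fun i => x i ∈ B).card := by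
      rw [hXdef, Finset.filter_image, Finset.card_image_of_injective _ hx.injective]
    omega

end Summit.Ventures.Crystal3D.Theorems

end
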